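import Summits.NavierStokesRegularity.FunctionalMining.NoGo.MiddleEigenvalueKillAllField
import Summits.NavierStokesRegularity.FunctionalMining.MiddleEigenvalueMomentDoor
import Mathlib.Analysis.Calculus.BumpFunction.InnerProduct
import Mathlib.Analysis.Calculus.LocalExtr.Basic
import Mathlib.MeasureTheory.Integral.IntegralEqImproper
import Mathlib.MeasureTheory.Measure.Haar.NormedSpace
import HarnessLib

/-!
# K1-Q2 KILL-ALL WITNESS, part 4/4: `∫|ω|²σ = 12π²XY > 0` and `∀ C, ¬ MiddleEigenvalueMomentRateBound 4 C`

Search for candidate a priori estimates; no regularity claim. NS FUNCTIONAL MINING — NO-GO BRANCH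
(cell `pub-nsfunc`, no-go seat gen 7).
**Theorem (`not_middleEigenvalueMomentRateBound_four`).** For every `C : ℝ` the conjectural
middle-eigenvalue moment rate law `MiddleEigenvalueMomentRateBound (d := Fin 3) 4 C`
(`dZ₄/dt ≤ C Λ Z₄` whenever `λ₂(S) ≤ Λ` pointwise; dictionary row E.q=4 | T_C | C3b, K1-Q2) is FALSE.
Proof: the explicit field `KillAll.fld` of part 3 is smooth, divergence free, has `λ₂(S) = 0`
everywhere, and `∫_{T³} |ω|² σ = 12 π² X Y` with `X = ∫ t A(t)² dt > 0`, `Y = ∫ t A'(t)² dt > 0`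
(pointwise expansion into fourteen separable monomials, Fubini on the cube, four exact vertical
integrals, translation/scaling of the horizontal ones); the tree's door
`middleEigenvalueMomentRateFails_of_nonpos_middle` (`MiddleEigenvalueMomentDoor.lean`, `m = 2`) turns
the static violation `0 < 4∫|ω|²σ` into `¬ MiddleEigenvalueMomentRateBound 4 C` for all `C`.
This is the kernel instance of the paper-level refutation of CONJECTURE S⁻(2) (no-go N11(j),
`KILLALL-WITNESS.md`); the reviewed finite-`C` records (`C < 36/23` kernel, `< 2.1381`) are superseded.
Nothing is asserted about Navier–Stokes regularity.
-/

noncomputable section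

open MeasureTheory Set Function Filter Topology Metric
open scoped ContDiff Real

namespace Summit.NavierStokesRegularity.FunctionalMining

namespace KillAll

open Literature.Analysis Literature.Analysis.FluidPDE Literature.Analysis.FunctionSpaces
  Literature.Analysis.FunctionSpaces.Torus

/-! ## The moment integral `∫ |ω|² σ`

Pointwise, `|ω|² σ` of the witness is a sum of fourteen separable monomials
`c · α(y₀) β(y₁) γ(y₂)` (table `table`); each integrates by Fubini; the vertical factors have
`∫₀¹ Vz Vz' = ∫₀¹ Vz Vz'³ = ∫₀¹ V³ Vz' = 0` and `∫₀¹ Vz Vz'² = 2π²`, and the surviving horizontal factors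
reduce by translation and scaling to `X = ∫ t A(t)² dt > 0` and `Y = ∫ t A'(t)² dt > 0`:
`∫ |ω|² σ = 12 π² X Y > 0`. -/

/-- The four vertical factors `Vz Vz'`, `Vz Vz'³`, `Vz Vz'²`, `V³ Vz'`. -/
def gam : Fin 4 → ℝ → ℝ
  | 0 => fun t => Vz t * dVz t
  | 1 => fun t => Vz t * dVz t ^ 3
  | 2 => fun t => Vz t * dVz t ^ 2
  | 3 => fun t => Vz t ^ 3 * dVz t

/-- Their integrals over `[0,1]`. -/
def gamInt : Fin 4 → ℝ
  | 0 => 0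
  | 1 => 0
  | 2 => 2 * π ^ 2
  | 3 => 0

/-- Auxiliary declaration `integral_gam` of the q = 4 witness evaluation (file 4/6) (NOGO N11 kill-all chain; search for candidate a priori estimates; no regularity claim). -/
theorem integral_gam (z : Fin 4) : ∫ t in (0 : ℝ)..1, gam z t = gamInt z := by
  fin_cases z
  · exact integral_V_dVz
  · exact integral_V_dV3
  · exact integral_V_dV2
  · exact integral_V3_dVz

/-- Auxiliary declaration `continuous_gam` of the q = 4 witness evaluation (file 4/6) (NOGO N11 kill-all chain; search for candidate a priori estimates; no regularity claim). -/
theorem continuous_gam (z : Fin 4) : Continuous (gam z) := by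
  fin_cases z
  · exact continuous_Vz.mul continuous_dVz
  · exact continuous_Vz.mul (continuous_dVz.pow 3)
  · exact continuous_Vz.mul (continuous_dVz.pow 2)
  · exact (continuous_Vz.pow 3).mul continuous_dVz

/-- One-dimensional `x`-integrals `∫ (t-½)ᵃ A(t-½)ᵇ A'(t-½)ᵉ dt`. -/
def Ia (a b e : ℕ) : ℝ := ∫ t, sh t ^ a * A (sh t) ^ b * deriv A (sh t) ^ e

/-- One-dimensional `y`-integrals `∫ (t-½)ᵃ A(2(t-½))ᵇ (2A'(2(t-½)))ᵉ dt`. -/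
def Ib (a b e : ℕ) : ℝ := ∫ t, sh t ^ a * A (2 * sh t) ^ b * (2 * deriv A (2 * sh t)) ^ e

/-- A row: coefficient, `x`-exponents `(a, b, e)` of `(t-½)ᵃ A(t-½)ᵇ A'(t-½)ᵉ`, `y`-exponents
`(a', b', e')` of `(t-½)ᵃ' A(2(t-½))ᵇ' (2A'(2(t-½)))ᵉ'`, and the vertical factor. -/
structure Row where
  /-- integer coefficient -/
  c : ℤ
  /-- `x`-weight exponent -/
  a : ℕ
  /-- `x`-profile exponent -/
  b : ℕ
  /-- `x`-profile-derivative exponent -/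
  e : ℕ
  /-- `y`-weight exponent -/
  a' : ℕ
  /-- `y`-profile exponent -/
  b' : ℕ
  /-- `y`-profile-derivative exponent -/
  e' : ℕ
  /-- vertical factor -/
  z : Fin 4

/-- `x`-factor of a row. -/
def Row.α (r : Row) (t : ℝ) : ℝ := sh t ^ r.a * A (sh t) ^ r.b * deriv A (sh t) ^ r.e

/-- `y`-factor of a row. -/
def Row.β (r : Row) (t : ℝ) : ℝ :=
  sh t ^ r.a' * A (2 * sh t) ^ r.b' * (2 * deriv A (2 * sh t)) ^ r.e'

/-- Pointwise value of a row (without its coefficient). -/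
def Row.fn (r : Row) (y : E3) : ℝ := r.α (y 0) * r.β (y 1) * gam r.z (y 2)

/-- Integrated value of a row (without its coefficient). -/
def Row.val (r : Row) : ℝ := Ia r.a r.b r.e * Ib r.a' r.b' r.e' * gamInt r.z

/-- **The fourteen monomials of `|ω|² σ`** for the witness (CAS-generated, kernel-checked below). -/
def table : List Row := [
  ⟨-4, 1, 2, 1, 0, 1, 2, 0⟩,
  ⟨-4, 1, 0, 3, 0, 3, 0, 0⟩,
  ⟨-4, 0, 3, 0, 1, 0, 3, 0⟩,
  ⟨-4, 0, 1, 2, 1, 2, 1, 0⟩,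
  ⟨-4, 3, 0, 1, 0, 1, 0, 1⟩,
  ⟨-4, 1, 0, 1, 2, 1, 0, 1⟩,
  ⟨-4, 2, 1, 0, 1, 0, 1, 1⟩,
  ⟨-4, 0, 1, 0, 3, 0, 1, 1⟩,
  ⟨-8, 1, 0, 2, 1, 2, 0, 2⟩,
  ⟨8, 2, 1, 1, 0, 1, 1, 2⟩,
  ⟨-8, 0, 1, 1, 2, 1, 1, 2⟩,
  ⟨8, 1, 2, 0, 1, 0, 2, 2⟩,
  ⟨-16, 1, 0, 1, 0, 1, 0, 3⟩,
  ⟨-16, 0, 1, 0, 1, 0, 1, 3⟩]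

/-- **Pointwise: `|ω|² σ` of the witness is the sum of the fourteen rows.** -/
theorem integrand_eq (ξ : UnitAddTorus (Fin 3)) :
    torusVorticitySqAt fld ξ * torusStretchingDensity fld ξ =
      (table.map fun r => (r.c : ℝ) * r.fn (repr ξ)).sum := by
  have key : ∀ y : E3, (gc (rs y) = 1 ∧ deriv gc (rs y) = 0) ∨
      (A (sh (y 0)) = 0 ∧ deriv A (sh (y 0)) = 0) ∨
      (A (2 * sh (y 1)) = 0 ∧ deriv A (2 * sh (y 1)) = 0) := fun y => by
    by_cases hp : |pc y - 1 / 4| < 1 / 8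
    · by_cases hq : |2 * qc y - 1 / 4| < 1 / 8
      · exact Or.inl (core_of_jet hp hq)
      · exact Or.inr (Or.inr (A_dA_eq_zero_of_not hq))
    · exact Or.inr (Or.inl (A_dA_eq_zero_of_not hp))
  simp only [torusVorticitySqAt, torusStretchingDensity, torusVorticityTensor, Fin.sum_univ_three,
    partialDeriv_fld]
  simp only [jac, pc, qc, Matrix.of_apply, Matrix.cons_val', Matrix.cons_val_zero,
    Matrix.cons_val_one, Matrix.cons_val_two, Matrix.head_cons, Matrix.tail_cons, Matrix.empty_val',
    Matrix.cons_val_fin_one, Matrix.head_fin_const]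
  simp only [table, List.map_cons, List.map_nil, List.sum_cons, List.sum_nil, Row.fn, Row.α, Row.β,
    gam, pow_zero, pow_one, one_mul, mul_one, Int.cast_ofNat, Int.cast_neg]
  rcases key (repr ξ) with ⟨h1, h0⟩ | ⟨h1, h0⟩ | ⟨h1, h0⟩
  · rw [h1, h0]; ring
  · rw [h1, h0]; ring
  · rw [h1, h0]; ring

/-! ### Row integrals -/

/-- Auxiliary declaration `A_sh_eq_zero` of the q = 4 witness evaluation (file 4/6) (NOGO N11 kill-all chain; search for candidate a priori estimates; no regularity claim). -/
theorem A_sh_eq_zero {t : ℝ} (ht : t ∉ Ioo (0 : ℝ) 1) : A (sh t) = 0 ∧ deriv A (sh t) = 0 := by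
  have hA : A (sh t) = 0 := by
    rcases le_or_gt t 0 with h | h
    · exact A_eq_zero_of_nonpos (by unfold sh; linarith)
    · have h1 : 1 ≤ t := not_lt.1 fun h1 => ht ⟨h, h1⟩
      exact A_eq_zero_of_ge (by unfold sh; linarith)
  exact ⟨hA, dA_eq_zero_of_A_eq_zero hA⟩

/-- Auxiliary declaration `A_two_sh_eq_zero` of the q = 4 witness evaluation (file 4/6) (NOGO N11 kill-all chain; search for candidate a priori estimates; no regularity claim). -/
theorem A_two_sh_eq_zero {t : ℝ} (ht : t ∉ Ioo (0 : ℝ) 1) :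
    A (2 * sh t) = 0 ∧ deriv A (2 * sh t) = 0 := by
  have hA : A (2 * sh t) = 0 := by
    rcases le_or_gt t 0 with h | h
    · exact A_eq_zero_of_nonpos (by unfold sh; linarith)
    · have h1 : 1 ≤ t := not_lt.1 fun h1 => ht ⟨h, h1⟩
      exact A_eq_zero_of_ge (by unfold sh; linarith)
  exact ⟨hA, dA_eq_zero_of_A_eq_zero hA⟩

/-- Auxiliary declaration `Row.α_eq_zero` of the q = 4 witness evaluation (file 4/6) (NOGO N11 kill-all chain; search for candidate a priori estimates; no regularity claim). -/
theorem Row.α_eq_zero (r : Row) (hr : r.b ≠ 0 ∨ r.e ≠ 0) {t : ℝ} (ht : t ∉ Ioo (0 : ℝ) 1) :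
    r.α t = 0 := by
  obtain ⟨h1, h0⟩ := A_sh_eq_zero ht
  unfold Row.α
  rw [h1, h0]
  rcases hr with h | h
  · rw [zero_pow h]; ring
  · rw [zero_pow h]; ring

/-- Auxiliary declaration `Row.β_eq_zero` of the q = 4 witness evaluation (file 4/6) (NOGO N11 kill-all chain; search for candidate a priori estimates; no regularity claim). -/
theorem Row.β_eq_zero (r : Row) (hr : r.b' ≠ 0 ∨ r.e' ≠ 0) {t : ℝ} (ht : t ∉ Ioo (0 : ℝ) 1) :
    r.β t = 0 := by
  obtain ⟨h1, h0⟩ := A_two_sh_eq_zero ht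
  unfold Row.β
  rw [h1, h0, mul_zero]
  rcases hr with h | h
  · rw [zero_pow h]; ring
  · rw [zero_pow h]; ring

/-- Auxiliary declaration `continuous_sh` of the q = 4 witness evaluation (file 4/6) (NOGO N11 kill-all chain; search for candidate a priori estimates; no regularity claim). -/
theorem continuous_sh : Continuous sh := contDiff_sh.continuous

/-- Auxiliary declaration `Row.continuous_α` of the q = 4 witness evaluation (file 4/6) (NOGO N11 kill-all chain; search for candidate a priori estimates; no regularity claim). -/
theorem Row.continuous_α (r : Row) : Continuous r.α := by
  unfold Row.α
  exact ((continuous_sh.pow _).mul ((continuous_A.comp continuous_sh).pow _)).mul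
    ((continuous_dA.comp continuous_sh).pow _)

/-- Auxiliary declaration `Row.continuous_β` of the q = 4 witness evaluation (file 4/6) (NOGO N11 kill-all chain; search for candidate a priori estimates; no regularity claim). -/
theorem Row.continuous_β (r : Row) : Continuous r.β := by
  unfold Row.β
  exact ((continuous_sh.pow _).mul
    ((continuous_A.comp (continuous_const.mul continuous_sh)).pow _)).mul
    ((continuous_const.mul (continuous_dA.comp (continuous_const.mul continuous_sh))).pow _)

/-- Auxiliary declaration `continuous_coord'` of the q = 4 witness evaluation (file 4/6) (NOGO N11 kill-all chain; search for candidate a priori estimates; no regularity claim). -/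
private theorem continuous_coord' (a : Fin 3) : Continuous fun y : E3 => y a :=
  (continuous_apply a).comp (PiLp.continuous_ofLp 2 _)

/-- Auxiliary declaration `Row.continuous_fn` of the q = 4 witness evaluation (file 4/6) (NOGO N11 kill-all chain; search for candidate a priori estimates; no regularity claim). -/
theorem Row.continuous_fn (r : Row) : Continuous r.fn := by
  unfold Row.fn
  exact ((r.continuous_α.comp (continuous_coord' 0)).mul
    (r.continuous_β.comp (continuous_coord' 1))).mul
    ((continuous_gam r.z).comp (continuous_coord' 2))

/-- Fubini for one row. -/
theorem Row.integral_fn (r : Row) (hr : r.b ≠ 0 ∨ r.e ≠ 0) (hr' : r.b' ≠ 0 ∨ r.e' ≠ 0) :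
    ∫ y in unitCube (Fin 3), r.fn y = r.val := by
  unfold Row.fn Row.val
  rw [setIntegral_unitCube_sep r.α r.β (gam r.z) (fun t ht => r.α_eq_zero hr ht)
    (fun t ht => r.β_eq_zero hr' ht), integral_gam]
  rfl

/-- Auxiliary declaration `table_exponents` of the q = 4 witness evaluation (file 4/6) (NOGO N11 kill-all chain; search for candidate a priori estimates; no regularity claim). -/
theorem table_exponents : ∀ r ∈ table, (r.b ≠ 0 ∨ r.e ≠ 0) ∧ (r.b' ≠ 0 ∨ r.e' ≠ 0) := by
  simp [table]

/-! ### The surviving one-dimensional integrals -/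

/-- Auxiliary declaration `Ia_011` of the q = 4 witness evaluation (file 4/6) (NOGO N11 kill-all chain; search for candidate a priori estimates; no regularity claim). -/
theorem Ia_011 : Ia 0 1 1 = 0 := by
  unfold Ia
  simp only [pow_zero, pow_one, one_mul]
  rw [show (fun t => A (sh t) * deriv A (sh t)) = fun t => (fun u => A u * deriv A u) (t - 1 / 2)
    from rfl, integral_sub_right_eq_self (fun u => A u * deriv A u) (1 / 2 : ℝ)]
  exact integral_mul_deriv_eq_zero (contDiff_A.of_le (by simp)) jetBump.hasCompactSupport

/-- Auxiliary declaration `Ib_011` of the q = 4 witness evaluation (file 4/6) (NOGO N11 kill-all chain; search for candidate a priori estimates; no regularity claim). -/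
theorem Ib_011 : Ib 0 1 1 = 0 := by
  unfold Ib
  simp only [pow_zero, pow_one, one_mul]
  rw [show (fun t => A (2 * sh t) * (2 * deriv A (2 * sh t))) =
      fun t => (fun u => A (2 * u) * (2 * deriv A (2 * u))) (t - 1 / 2) from rfl,
    integral_sub_right_eq_self (fun u => A (2 * u) * (2 * deriv A (2 * u))) (1 / 2 : ℝ),
    Measure.integral_comp_mul_left (fun w => A w * (2 * deriv A w)) 2]
  have h : ∫ w, A w * (2 * deriv A w) = 2 * ∫ w, A w * deriv A w := by
    rw [← integral_const_mul]; congr 1; funext w; ring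
  rw [h, integral_mul_deriv_eq_zero (contDiff_A.of_le (by simp)) jetBump.hasCompactSupport]
  simp

/-- Auxiliary declaration `Ib_120` of the q = 4 witness evaluation (file 4/6) (NOGO N11 kill-all chain; search for candidate a priori estimates; no regularity claim). -/
theorem Ib_120 : Ib 1 2 0 = Ia 1 2 0 / 4 := by
  unfold Ia Ib
  simp only [pow_zero, pow_one, mul_one]
  rw [show (fun t => sh t * A (2 * sh t) ^ 2) = fun t => (fun u => u * A (2 * u) ^ 2) (t - 1 / 2)
    from rfl, integral_sub_right_eq_self (fun u => u * A (2 * u) ^ 2) (1 / 2 : ℝ),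
    show (fun t => sh t * A (sh t) ^ 2) = fun t => (fun u => u * A u ^ 2) (t - 1 / 2) from rfl,
    integral_sub_right_eq_self (fun u => u * A u ^ 2) (1 / 2 : ℝ)]
  have h1 : (fun u : ℝ => u * A (2 * u) ^ 2) = fun u => (fun w => w / 2 * A w ^ 2) (2 * u) := by
    funext u; ring_nf
  rw [h1, Measure.integral_comp_mul_left (fun w => w / 2 * A w ^ 2) 2]
  have h2 : ∫ w, w / 2 * A w ^ 2 = 2⁻¹ * ∫ w, w * A w ^ 2 := by
    rw [← integral_const_mul]; congr 1; funext w; ring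
  rw [h2, abs_of_pos (by norm_num : (0 : ℝ) < 2⁻¹), smul_eq_mul]
  ring

/-- Auxiliary declaration `Ib_102` of the q = 4 witness evaluation (file 4/6) (NOGO N11 kill-all chain; search for candidate a priori estimates; no regularity claim). -/
theorem Ib_102 : Ib 1 0 2 = Ia 1 0 2 := by
  unfold Ia Ib
  simp only [pow_zero, pow_one, mul_one]
  rw [show (fun t => sh t * (2 * deriv A (2 * sh t)) ^ 2) =
      fun t => (fun u => u * (2 * deriv A (2 * u)) ^ 2) (t - 1 / 2) from rfl,
    integral_sub_right_eq_self (fun u => u * (2 * deriv A (2 * u)) ^ 2) (1 / 2 : ℝ),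
    show (fun t => sh t * deriv A (sh t) ^ 2) = fun t => (fun u => u * deriv A u ^ 2) (t - 1 / 2)
    from rfl, integral_sub_right_eq_self (fun u => u * deriv A u ^ 2) (1 / 2 : ℝ)]
  have h1 : (fun u : ℝ => u * (2 * deriv A (2 * u)) ^ 2) =
      fun u => (fun w => 2 * (w * deriv A w ^ 2)) (2 * u) := by
    funext u; ring_nf
  rw [h1, Measure.integral_comp_mul_left (fun w => 2 * (w * deriv A w ^ 2)) 2, integral_const_mul,
    abs_of_pos (by norm_num : (0 : ℝ) < 2⁻¹), smul_eq_mul]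
  ring

/-- `X = ∫ (t-½) A(t-½)² dt > 0`. -/
theorem Ia_120_pos : 0 < Ia 1 2 0 := by
  unfold Ia
  simp only [pow_one, pow_zero, mul_one]
  refine Continuous.integral_pos_of_hasCompactSupport_nonneg_nonzero (x := (3 / 4 : ℝ))
    (continuous_sh.mul ((continuous_A.comp continuous_sh).pow 2)) ?_ ?_ ?_
  · refine HasCompactSupport.intro (isCompact_Icc : IsCompact (Icc (0 : ℝ) 1)) fun t ht => ?_
    have ht' : t ∉ Ioo (0 : ℝ) 1 := fun h => ht (Ioo_subset_Icc_self h)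
    simp [(A_sh_eq_zero ht').1]
  · intro t
    simp only [Pi.zero_apply]
    by_cases h : sh t ≤ 1 / 8
    · simp [A_eq_zero_of_nonpos h]
    · exact mul_nonneg (by linarith) (sq_nonneg _)
  · have : sh (3 / 4) = 1 / 4 := by unfold sh; norm_num
    simp only [this, A_center]; norm_num

/-- Auxiliary declaration `exists_dA_ne_zero` of the q = 4 witness evaluation (file 4/6) (NOGO N11 kill-all chain; search for candidate a priori estimates; no regularity claim). -/
theorem exists_dA_ne_zero : ∃ c : ℝ, 1 / 4 < c ∧ deriv A c ≠ 0 := by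
  obtain ⟨c, hc, hd⟩ := exists_deriv_eq_slope A (by norm_num : (1 / 4 : ℝ) < 3 / 8)
    continuous_A.continuousOn (differentiable_A.differentiableOn)
  refine ⟨c, hc.1, ?_⟩
  rw [hd, A_center, A_three_eighths]; norm_num

/-- `Y = ∫ (t-½) A'(t-½)² dt > 0`. -/
theorem Ia_102_pos : 0 < Ia 1 0 2 := by
  obtain ⟨c, hc, hd⟩ := exists_dA_ne_zero
  unfold Ia
  simp only [pow_one, pow_zero, mul_one]
  refine Continuous.integral_pos_of_hasCompactSupport_nonneg_nonzero (x := c + 1 / 2)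
    (continuous_sh.mul ((continuous_dA.comp continuous_sh).pow 2)) ?_ ?_ ?_
  · refine HasCompactSupport.intro (isCompact_Icc : IsCompact (Icc (0 : ℝ) 1)) fun t ht => ?_
    have ht' : t ∉ Ioo (0 : ℝ) 1 := fun h => ht (Ioo_subset_Icc_self h)
    simp [(A_sh_eq_zero ht').2]
  · intro t
    simp only [Pi.zero_apply]
    by_cases h : sh t ≤ 1 / 8
    · simp [dA_eq_zero_of_A_eq_zero (A_eq_zero_of_nonpos h)]
    · exact mul_nonneg (by linarith) (sq_nonneg _)
  · have : sh (c + 1 / 2) = c := by unfold sh; ring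
    simp only [this]
    exact mul_ne_zero (by linarith) (pow_ne_zero 2 hd)

/-! ### The value of the moment integral -/

/-- **`∫_{T³} |ω|² σ = 12 π² X Y` for the witness.** -/
theorem integral_vortSq_mul_stretching :
    ∫ ξ, torusVorticitySqAt fld ξ * torusStretchingDensity fld ξ =
      12 * π ^ 2 * (Ia 1 2 0 * Ia 1 0 2) := by
  simp_rw [integrand_eq]
  rw [integral_comp_repr (fun y : E3 => (table.map fun r => (r.c : ℝ) * r.fn y).sum)]
  have hrow : ∀ r ∈ table, Integrable r.fn (volume.restrict (unitCube (Fin 3))) :=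
    fun r _ => integrableOn_unitCube r.continuous_fn
  rw [Sep3.integral_listSum (fun r : Row => (r.c : ℝ)) (fun r => r.fn) table hrow]
  have hval : ∀ r ∈ table, (r.c : ℝ) * ∫ y in unitCube (Fin 3), r.fn y = (r.c : ℝ) * r.val :=
    fun r hr => by rw [r.integral_fn (table_exponents r hr).1 (table_exponents r hr).2]
  rw [List.map_congr_left hval]
  simp only [table, List.map_cons, List.map_nil, List.sum_cons, List.sum_nil, Row.val, gamInt,
    Ib_011, Ia_011, Ib_120, Ib_102, Int.cast_ofNat, Int.cast_neg]
  ring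

/-- **The moment integral is positive.** -/
theorem integral_vortSq_mul_stretching_pos :
    0 < ∫ ξ, torusVorticitySqAt fld ξ * torusStretchingDensity fld ξ := by
  rw [integral_vortSq_mul_stretching]
  have := Ia_120_pos
  have := Ia_102_pos
  positivity


/-! ## Through the door: every constant is refuted at `q = 4` -/

/-- The middle strain eigenvalue of the witness is `≤ 0` everywhere (it is `= 0`). -/
theorem middle_nonpos_fld : ∀ x : UnitAddTorus (Fin 3), ∀ hx : (Matrix.of fun i j =>
    (Torus.partialDeriv j fld x i + Torus.partialDeriv i fld x j) / 2).IsHermitian,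
    hx.eigenvalues₀ (Fin.cast (Fintype.card_fin 3).symm 1) ≤ 0 := fun x hx =>
  (middle_eq_zero x hx).le

/-- **KILL-ALL WITNESS (K1-Q2, `q = 4`).** The conjectural middle-eigenvalue moment rate law
`dZ₄/dt ≤ C Λ Z₄` (`MiddleEigenvalueMomentRateBound 4 C`, dictionary row E.q=4 | T_C | C3b) fails on
`T³` for EVERY constant `C`: the explicit smooth divergence-free field `fld` has `λ₂(S) = 0`
everywhere and `∫ |ω|² σ = 12π² X Y > 0`, so the static consequence `4∫|ω|²σ ≤ C·0·Z₄` of the law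
(door `middleEigenvalueMomentRateFails_of_nonpos_middle`) is violated. Search for candidate a priori
estimates; no regularity claim. [ours] -/
theorem not_middleEigenvalueMomentRateBound_four (C : ℝ) :
    ¬ MiddleEigenvalueMomentRateBound (d := Fin 3) 4 C := by
  have hpos : 0 < 2 * ((2 : ℕ) : ℝ) *
      ∫ x, torusVorticitySqAt fld x ^ (2 - 1) * torusStretchingDensity fld x := by
    have h := integral_vortSq_mul_stretching_pos
    simp only [show (2 : ℕ) - 1 = 1 from rfl, pow_one]
    positivity
  have h := middleEigenvalueMomentRateFails_of_nonpos_middle (m := 2) (Fintype.card_fin 3)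
    isSmooth_fld isDivFree_fld middle_nonpos_fld hpos C
  have e : ((2 : ℝ) * ((2 : ℕ) : ℝ)) = 4 := by norm_num
  rw [e] at h
  exact h

/-- The same, quantified. -/
theorem middleEigenvalueMomentRate_four_killAll :
    ∀ C : ℝ, ¬ MiddleEigenvalueMomentRateBound (d := Fin 3) 4 C :=
  not_middleEigenvalueMomentRateBound_four

end KillAll

end Summit.NavierStokesRegularity.FunctionalMining

end
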